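import Mathlib
import HarnessLib
import Summits.NavierStokesRegularity.NavierStokesRegularity.Theorems.PlaneStrainDoorProfileLiouvilles
import Summits.NavierStokesRegularity.NavierStokesRegularity.Theorems.LocalHelicityTubeDoorFrobeniusWindowRigidityWindow

/-!
# nsreg-p1 ROUND-15 doors S16 / S16′: window-to-slab for the two first-order scalars and the profile cruxes
# K2 `ProductionFreeProfileRigidity`, K2′ `PlaneStrainProfileRigidity` — PROVED

The sketch's support `WindowToSlab F` for `F = stretchF` (`A ↦ ⟪curlCLM A, A (curlCLM A)⟫ = ω·Sω`) and
`F = strainDet` (`A ↦ (A + A†).det`, Betchov's invariant): for a profile of the Type-I class (time rate, continuity,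
Oseen–Duhamel identity) the slice scalars `y ↦ F(∇v(s,y))` are REAL-ANALYTIC (slice analyticity
`analyticOnNhd_slice`, `AnalyticOnNhd.fderiv`, evaluation and inner product bilinear; for `strainDet` the determinant
is the cubic polynomial `det (Gᵢⱼ + Gⱼᵢ)` in the analytic entries `Gᵢⱼ = (∇v eⱼ)ᵢ`), so vanishing on one nonempty
open window of a slice spreads to the whole slice (`real_eq_zero_spread`).  Composed with the slab Liouvilles of
`PlaneStrainDoorProfileLiouvilles` this proves the sketch's cruxes in their WINDOW form:

* `stretchWindowToSlab`, `strainDetWindowToSlab` — the texts of `WindowToSlab stretchF`, `WindowToSlab strainDet`;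
* `productionFreeProfileRigidity` — text of crux K2 `ProductionFreeProfileRigidity` (rank 2);
* `planeStrainProfileRigidity` — text of crux K2′ `PlaneStrainProfileRigidity` (rank 2′).

With the sketch's proved assemblies `target_of_rigidity` / `targetPlaneStrain_of_rigidity` the doors S16 `Target`
and S16′ `TargetPlaneStrain` are theorems modulo transcription of the sketch's K1 glue.  Seat nsreg-p6 g8.
WHAT THIS IS NOT: not NS regularity (Clay A) — profile theorems of CONDITIONAL one-window doors; not a route open.
-/

noncomputable section

open MeasureTheory Set Function Filter Topology InnerProductSpace
open scoped ENNReal NNReal RealInnerProductSpace ContDiff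
open Literature.Analysis Literature.Analysis.FluidPDE
open Summit.NavierStokesRegularity.NavierStokesRegularity.Theorems.LocalSineTubeDoorProfileAlignedWindowRigidityAncient
open Summit.NavierStokesRegularity.NavierStokesRegularity.Theorems.LocalHelicityTubeDoorFrobeniusWindowRigidityWindow
open Summit.NavierStokesRegularity.NavierStokesRegularity.Theorems.PlaneStrainDoorProfileLiouvilles

-- the summit and its single sub-problem share the name (CONVENTIONS §1), as in every Theorems file
set_option linter.dupNamespace false

namespace Summit.NavierStokesRegularity.NavierStokesRegularity.Theorems.PlaneStrainDoorProfileWindowToSlab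

variable {C D : ℝ} {v : ℝ → EuclideanSpace ℝ (Fin 3) → EuclideanSpace ℝ (Fin 3)}

/-! ### Analyticity of the two slice scalars -/

/-- Evaluation of an analytic operator field at an analytic vector field is analytic. -/
theorem analyticOnNhd_clm_apply {L : EuclideanSpace ℝ (Fin 3) → (EuclideanSpace ℝ (Fin 3) →L[ℝ] EuclideanSpace ℝ (Fin 3))}
    {w : EuclideanSpace ℝ (Fin 3) → EuclideanSpace ℝ (Fin 3)}
    (hL : AnalyticOnNhd ℝ L univ) (hw : AnalyticOnNhd ℝ w univ) :
    AnalyticOnNhd ℝ (fun y => L y (w y)) univ := fun y hy =>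
  ((ContinuousLinearMap.id ℝ (EuclideanSpace ℝ (Fin 3) →L[ℝ] EuclideanSpace ℝ (Fin 3))).analyticAt_bilinear
    (L y, w y)).comp₂ (hL y hy) (hw y hy)

/-- **The enstrophy production density of a slice of the class is real-analytic**:
`y ↦ ⟪curl ∇v(s,y), ∇v(s,y) (curl ∇v(s,y))⟫`. -/
theorem analyticOnNhd_stretch_slice (hrate : HasTypeITimeDecay C v)
    (hcont : ContinuousOn (uncurry v) (Iio (0 : ℝ) ×ˢ univ))
    (hmild : ∀ s t : ℝ, s < t → t < 0 → ∀ x,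
      v t x = UnboundedOperators.heatExtension (v s) (t - s) x - oseenDuhamel 1 s v v t x)
    {s : ℝ} (hs : s < 0) :
    AnalyticOnNhd ℝ (fun y => inner ℝ (curlCLM (fderiv ℝ (v s) y))
      ((fderiv ℝ (v s) y) (curlCLM (fderiv ℝ (v s) y)))) univ := by
  have hslice := analyticOnNhd_slice hcont (bdd_of_hasTypeITimeDecay hrate) hmild hs
  have hD : AnalyticOnNhd ℝ (fderiv ℝ (v s)) univ := hslice.fderiv
  have hcurl : AnalyticOnNhd ℝ (fun y => curlCLM (fderiv ℝ (v s) y)) univ := analyticOnNhd_curl hslice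
  exact analyticOnNhd_inner hcurl (analyticOnNhd_clm_apply hD hcurl)

/-- The standard matrix of `L + L†` is `G + Gᵀ`: `(L + L†).det = det (Gᵢⱼ + Gⱼᵢ)`. -/
theorem det_add_adjoint_eq_det_of (L : EuclideanSpace ℝ (Fin 3) →L[ℝ] EuclideanSpace ℝ (Fin 3)) :
    (L + ContinuousLinearMap.adjoint L).det =
      Matrix.det (Matrix.of fun i j =>
        stdMatrix (L : EuclideanSpace ℝ (Fin 3) →ₗ[ℝ] EuclideanSpace ℝ (Fin 3)) i j +
        stdMatrix (L : EuclideanSpace ℝ (Fin 3) →ₗ[ℝ] EuclideanSpace ℝ (Fin 3)) j i) := by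
  set M : EuclideanSpace ℝ (Fin 3) →ₗ[ℝ] EuclideanSpace ℝ (Fin 3) :=
    ((L + ContinuousLinearMap.adjoint L : EuclideanSpace ℝ (Fin 3) →L[ℝ] EuclideanSpace ℝ (Fin 3)) :
      EuclideanSpace ℝ (Fin 3) →ₗ[ℝ] EuclideanSpace ℝ (Fin 3)) with hM
  have hdet : (L + ContinuousLinearMap.adjoint L).det = Matrix.det (stdMatrix M) := by
    rw [hM]
    exact (LinearMap.det_toMatrix _ _).symm
  rw [hdet]
  congr 1
  ext i j
  rw [Matrix.of_apply, stdMatrix_apply, stdMatrix_apply, stdMatrix_apply, hM]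
  simp only [ContinuousLinearMap.coe_coe]
  change (L (EuclideanSpace.single j (1 : ℝ)) +
    ContinuousLinearMap.adjoint L (EuclideanSpace.single j (1 : ℝ))) i = _
  rw [PiLp.add_apply]
  congr 1
  have h1 : (ContinuousLinearMap.adjoint L (EuclideanSpace.single j (1 : ℝ))) i =
      ⟪ContinuousLinearMap.adjoint L (EuclideanSpace.single j (1 : ℝ)), EuclideanSpace.single i (1 : ℝ)⟫_ℝ := by
    rw [EuclideanSpace.inner_single_right]; simp
  rw [h1, ContinuousLinearMap.adjoint_inner_left, EuclideanSpace.inner_single_left]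
  simp

/-- The matrix entries `y ↦ (∇v(s,y) eⱼ)ᵢ` of an analytic operator field are analytic. -/
theorem analyticOnNhd_entry {L : EuclideanSpace ℝ (Fin 3) → (EuclideanSpace ℝ (Fin 3) →L[ℝ] EuclideanSpace ℝ (Fin 3))}
    (hL : AnalyticOnNhd ℝ L univ) (i j : Fin 3) :
    AnalyticOnNhd ℝ (fun y => stdMatrix (L y : EuclideanSpace ℝ (Fin 3) →ₗ[ℝ] EuclideanSpace ℝ (Fin 3)) i j)
      univ := by
  have h1 : AnalyticOnNhd ℝ (fun y => L y (EuclideanSpace.single j (1 : ℝ))) univ :=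
    analyticOnNhd_clm_apply hL (fun y _ => analyticAt_const)
  have h2 := (EuclideanSpace.proj (𝕜 := ℝ) (ι := Fin 3) i).comp_analyticOnNhd h1
  have heq : (fun y => stdMatrix (L y : EuclideanSpace ℝ (Fin 3) →ₗ[ℝ] EuclideanSpace ℝ (Fin 3)) i j) =
      (EuclideanSpace.proj (𝕜 := ℝ) (ι := Fin 3) i) ∘ fun y => L y (EuclideanSpace.single j (1 : ℝ)) := by
    funext y
    rw [Function.comp_apply, stdMatrix_apply, ContinuousLinearMap.coe_coe]
    rfl
  rw [heq]
  exact h2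

/-- **Betchov's invariant of a slice of the class is real-analytic**: `y ↦ det (∇v(s,y) + ∇v(s,y)ᵀ)`. -/
theorem analyticOnNhd_strainDet_slice (hrate : HasTypeITimeDecay C v)
    (hcont : ContinuousOn (uncurry v) (Iio (0 : ℝ) ×ˢ univ))
    (hmild : ∀ s t : ℝ, s < t → t < 0 → ∀ x,
      v t x = UnboundedOperators.heatExtension (v s) (t - s) x - oseenDuhamel 1 s v v t x)
    {s : ℝ} (hs : s < 0) :
    AnalyticOnNhd ℝ (fun y => (fderiv ℝ (v s) y + ContinuousLinearMap.adjoint (fderiv ℝ (v s) y)).det) univ := by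
  have hslice := analyticOnNhd_slice hcont (bdd_of_hasTypeITimeDecay hrate) hmild hs
  have hD : AnalyticOnNhd ℝ (fderiv ℝ (v s)) univ := hslice.fderiv
  set G : Fin 3 → Fin 3 → EuclideanSpace ℝ (Fin 3) → ℝ := fun i j y =>
    stdMatrix (fderiv ℝ (v s) y : EuclideanSpace ℝ (Fin 3) →ₗ[ℝ] EuclideanSpace ℝ (Fin 3)) i j with hG
  have hGa : ∀ i j y, AnalyticAt ℝ (G i j) y := fun i j y => analyticOnNhd_entry hD i j y (mem_univ y)
  have heq : (fun y => (fderiv ℝ (v s) y + ContinuousLinearMap.adjoint (fderiv ℝ (v s) y)).det) =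
      fun y => Matrix.det (Matrix.of fun i j => G i j y + G j i y) := by
    funext y; rw [det_add_adjoint_eq_det_of]
  rw [heq]
  intro y _
  simp only [Matrix.det_fin_three, Matrix.of_apply]
  fun_prop

/-! ### Window to slab -/

/-- **support `WindowToSlab stretchF`** (text of nsreg-p1 `r15/Sketch16.lean`, `stretchF` unfolded): on the Type-I
class, if at every `s < 0` the production density `⟪curl ∇v, ∇v (curl ∇v)⟫(s,·)` vanishes on some nonempty open set,
it vanishes identically on every slice. -/
theorem stretchWindowToSlab :
    ∀ (C : ℝ) (v : ℝ → EuclideanSpace ℝ (Fin 3) → EuclideanSpace ℝ (Fin 3)),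
    HasTypeITimeDecay C v →
    ContinuousOn (Function.uncurry v) (Set.Iio (0 : ℝ) ×ˢ Set.univ) →
    (∀ s t : ℝ, s < t → t < 0 → ∀ x, v t x =
      UnboundedOperators.heatExtension (v s) (t - s) x - oseenDuhamel 1 s v v t x) →
    (∀ s < 0, ∃ U : Set (EuclideanSpace ℝ (Fin 3)), IsOpen U ∧ U.Nonempty ∧ ∀ z ∈ U,
      inner ℝ (curlCLM (fderiv ℝ (v s) z)) ((fderiv ℝ (v s) z) (curlCLM (fderiv ℝ (v s) z))) = 0) →
    ∀ s < 0, ∀ z, inner ℝ (curlCLM (fderiv ℝ (v s) z)) ((fderiv ℝ (v s) z) (curlCLM (fderiv ℝ (v s) z))) = 0 := by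
  intro C v hrate hcont hmild hwin s hs
  obtain ⟨U, hU, hne, hal⟩ := hwin s hs
  exact real_eq_zero_spread (analyticOnNhd_stretch_slice hrate hcont hmild hs) hU hne hal

/-- **support `WindowToSlab strainDet`** (text of nsreg-p1 `r15/Sketch16.lean`, `strainDet` unfolded): on the Type-I
class, if at every `s < 0` Betchov's invariant `det (∇v + ∇vᵀ)(s,·)` vanishes on some nonempty open set, it vanishes
identically on every slice. -/
theorem strainDetWindowToSlab :
    ∀ (C : ℝ) (v : ℝ → EuclideanSpace ℝ (Fin 3) → EuclideanSpace ℝ (Fin 3)),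
    HasTypeITimeDecay C v →
    ContinuousOn (Function.uncurry v) (Set.Iio (0 : ℝ) ×ˢ Set.univ) →
    (∀ s t : ℝ, s < t → t < 0 → ∀ x, v t x =
      UnboundedOperators.heatExtension (v s) (t - s) x - oseenDuhamel 1 s v v t x) →
    (∀ s < 0, ∃ U : Set (EuclideanSpace ℝ (Fin 3)), IsOpen U ∧ U.Nonempty ∧ ∀ z ∈ U,
      (fderiv ℝ (v s) z + ContinuousLinearMap.adjoint (fderiv ℝ (v s) z)).det = 0) →
    ∀ s < 0, ∀ z, (fderiv ℝ (v s) z + ContinuousLinearMap.adjoint (fderiv ℝ (v s) z)).det = 0 := by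
  intro C v hrate hcont hmild hwin s hs
  obtain ⟨U, hU, hne, hal⟩ := hwin s hs
  exact real_eq_zero_spread (analyticOnNhd_strainDet_slice hrate hcont hmild hs) hU hne hal

/-! ### The window-form profile cruxes K2, K2′ -/

/-- **crux (rank 2) K2 `ProductionFreeProfileRigidity`** (text of nsreg-p1 `r15/Sketch16.lean`, `stretchF` unfolded),
PROVED: a door-class profile with space–time Type-I decay whose enstrophy production density vanishes on some
nonempty open set of EVERY slice is not backward-singular at the apex. -/
theorem productionFreeProfileRigidity :
    ∀ (C D : ℝ) (v : ℝ → EuclideanSpace ℝ (Fin 3) → EuclideanSpace ℝ (Fin 3)),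
    HasTypeITimeDecay C v →
    HasTypeIDecay D v →
    ContinuousOn (Function.uncurry v) (Set.Iio (0 : ℝ) ×ˢ Set.univ) →
    (∀ s t : ℝ, s < t → t < 0 → ∀ x, v t x =
      UnboundedOperators.heatExtension (v s) (t - s) x - oseenDuhamel 1 s v v t x) →
    (∀ t < 0, VectorCalculus.IsDivFree (v t)) →
    (∀ s < 0, ∃ U : Set (EuclideanSpace ℝ (Fin 3)), IsOpen U ∧ U.Nonempty ∧ ∀ z ∈ U,
      inner ℝ (curlCLM (fderiv ℝ (v s) z)) ((fderiv ℝ (v s) z) (curlCLM (fderiv ℝ (v s) z))) = 0) →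
    ¬ IsBackwardSingularPoint v 0 :=
  fun C _ v hrate hdec hcont hmild hdiv hwin =>
    productionFreeProfileRigidity_slab hrate hdec hcont hmild hdiv (stretchWindowToSlab C v hrate hcont hmild hwin)

/-- **crux (rank 2′) K2′ `PlaneStrainProfileRigidity`** (text of nsreg-p1 `r15/Sketch16.lean`, `strainDet` unfolded),
PROVED: a door-class profile with space–time Type-I decay with `det (∇v + ∇vᵀ) = 0` on some nonempty open set of
every slice is not backward-singular at the apex. -/
theorem planeStrainProfileRigidity :
    ∀ (C D : ℝ) (v : ℝ → EuclideanSpace ℝ (Fin 3) → EuclideanSpace ℝ (Fin 3)),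
    HasTypeITimeDecay C v →
    HasTypeIDecay D v →
    ContinuousOn (Function.uncurry v) (Set.Iio (0 : ℝ) ×ˢ Set.univ) →
    (∀ s t : ℝ, s < t → t < 0 → ∀ x, v t x =
      UnboundedOperators.heatExtension (v s) (t - s) x - oseenDuhamel 1 s v v t x) →
    (∀ t < 0, VectorCalculus.IsDivFree (v t)) →
    (∀ s < 0, ∃ U : Set (EuclideanSpace ℝ (Fin 3)), IsOpen U ∧ U.Nonempty ∧ ∀ z ∈ U,
      (fderiv ℝ (v s) z + ContinuousLinearMap.adjoint (fderiv ℝ (v s) z)).det = 0) →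
    ¬ IsBackwardSingularPoint v 0 :=
  fun C _ v hrate hdec hcont hmild hdiv hwin =>
    planeStrainProfileRigidity_slab hrate hdec hcont hmild hdiv (strainDetWindowToSlab C v hrate hcont hmild hwin)

end Summit.NavierStokesRegularity.NavierStokesRegularity.Theorems.PlaneStrainDoorProfileWindowToSlab

end
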